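import Summits.ValiantsHypothesis.ValiantsHypothesis.Theorems.LacunarySymmetroidMatrixDescartesFanLaw
import Summits.ValiantsHypothesis.ValiantsHypothesis.Theorems.LacunarySymmetroidMatrixDescartesVLawDegree

/-!
# `MatrixDescartes` (stmt-ValiantsHypothesis-18050), line `Lift` — registered research stub `stub_vLaw` (the V-LAW) PROVED

HONEST FRAMING.  Cell `pub-symmetroid`, seat `val-sym-mdr-p2` (gen 2).  This file proves, by name and signature,
the registered research stub `stub_vLaw` of the crux's line `Lift` (`Cruxes/MatrixDescartes/Lines/Lift.lean`, leads
c1–c3, 2026-08-17: «RESEARCH-LEVEL (no proof known; registered so that the disprover and siege seats attack the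
sharpest true-looking statement of the two-sided core)»).  Paper proof: `VLAW-PROOF.md` (evidence #43 on the item,
predecessor seat g0, 2026-08-26); kernel chain: `…VLawStieltjes` (rpow-free Stieltjes identities) → `…VLawNormalForm`
(H-form algebra, partial fractions, Gram-entry integrals) → `…VLawCore` (STAR core lemma = Lemma FULL) → `…FanLaw`
(chain reduction, fan law) → here; the equal-gap case is the degree count `vLaw_equalGaps` (`…VLawDegree`, p419950).
The OTHER registered stub `stub_twoSided` (≅ the crux `MatrixDescartes`, `…LiftNormalForm`) is untouched: the
V-law is a `K = 3` two-sided rung (one PSD letter on each side of a symmetric pivot); with two letters on one side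
`3n` occurs at `n = 2` (`not_wLaw_two`) unless the fan condition of `…FanLaw` holds.  Nothing here bears on
`MatrixDescartes` in its window, `DoorA26`/`DoorA34`, or `VP ≠ VNP`.

THE V-LAW.  For real `ι × ι` matrices, `J` symmetric, `P, Q ⪰ 0`, exponents `d₁ < e < d₂`:
`det (X^e J + X^{d₁} P + X^{d₂} Q)` has at most `2 · card ι` distinct positive zeros (sharp: `2n` is attained by
commuting data).  [folklore] given the companion files.
-/

-- layout Summits/ValiantsHypothesis/ValiantsHypothesis forces the duplicated namespace component
set_option linter.dupNamespace false

namespace Summit.ValiantsHypothesis.ValiantsHypothesis.Theorems.LacunarySymmetroidMatrixDescartes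

open Polynomial Matrix Finset FanLaw
open scoped BigOperators

/-- **Registered research stub `stub_vLaw` of line `Lift` — the V-LAW, PROVED.**  For real `ι × ι` matrices with
`J` symmetric, `P, Q ⪰ 0` and exponents `d₁ < e < d₂`, `det (X^e J + X^{d₁} P + X^{d₂} Q)` has at most `2 · card ι`
distinct positive zeros.  Cases: `e − d₁ > d₂ − e` is the lower fan law with lone letter `P`; `e − d₁ < d₂ − e` the upper
fan law with lone letter `Q`; equal gaps is the degree count `vLaw_equalGaps` (p419950).  Paper proof: `VLAW-PROOF.md`
(evidence #43 on stmt-ValiantsHypothesis-18050, seat val-sym-mdr-p2 g0). [folklore] -/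
theorem stub_vLaw (ι : Type) [Fintype ι] [DecidableEq ι] (e d₁ d₂ : ℕ) (J P Q : Matrix ι ι ℝ)
    (hJ : J.IsSymm) (hP : P.PosSemidef) (hQ : Q.PosSemidef) (h₁ : d₁ < e) (h₂ : e < d₂) :
    ((Matrix.det (((Polynomial.X : Polynomial ℝ) ^ e) • J.map Polynomial.C
        + ((Polynomial.X : Polynomial ℝ) ^ d₁) • P.map Polynomial.C
        + ((Polynomial.X : Polynomial ℝ) ^ d₂) • Q.map Polynomial.C)).roots.toFinset.filter
          (fun t => 0 < t)).card ≤ 2 * Fintype.card ι := by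
  classical
  have hPQ : ∀ k : Fin 2, ((![P, Q] : Fin 2 → Matrix ι ι ℝ) k).PosSemidef := by
    intro k
    fin_cases k
    · exact hP
    · exact hQ
  have hsum : ((Polynomial.X : Polynomial ℝ) ^ e) • J.map Polynomial.C
        + ((Polynomial.X : Polynomial ℝ) ^ d₁) • P.map Polynomial.C
        + ((Polynomial.X : Polynomial ℝ) ^ d₂) • Q.map Polynomial.C
      = ((Polynomial.X : Polynomial ℝ) ^ e) • J.map Polynomial.C
        + ∑ k : Fin 2, ((Polynomial.X : Polynomial ℝ) ^ (![d₁, d₂] : Fin 2 → ℕ) k)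
          • ((![P, Q] : Fin 2 → Matrix ι ι ℝ) k).map Polynomial.C := by
    rw [Fin.sum_univ_two, add_assoc]
    rfl
  rw [hsum]
  rcases lt_trichotomy (e - d₁) (d₂ - e) with hlt | heq | hgt
  · -- lone UPPER letter `Q` (index 1)
    refine fanLaw_upper e ![d₁, d₂] J ![P, Q] 1 hJ hPQ (show e < d₂ from h₂) fun k hk => ?_
    fin_cases k
    · exact ⟨h₁, hlt⟩
    · exact absurd rfl hk
  · -- equal gaps: degree count (tree)
    rw [← hsum]
    exact vLaw_equalGaps ι e d₁ d₂ J P Q h₁ h₂ heq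
  · -- lone LOWER letter `P` (index 0)
    refine fanLaw_lower e ![d₁, d₂] J ![P, Q] 0 hJ hPQ (show d₁ < e from h₁) fun k hk => ?_
    fin_cases k
    · exact absurd rfl hk
    · exact ⟨h₂, hgt⟩

end Summit.ValiantsHypothesis.ValiantsHypothesis.Theorems.LacunarySymmetroidMatrixDescartes
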